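import Summits.KontsevichZagierPeriods.KontsevichZagierPeriods.Theorems.FermatIsogenyBetaProductSectorStubQuadStepChart
import Literature.NumberTheory.Transcendental.KZMellinFibres
import Mathlib.Analysis.Calculus.Deriv.Inv

/-!
# `BetaProductSector` (stmt-KontsevichZagierPeriods-3898), line `registered` (v3) — stub `stub_twinDupStep`,
# part 1: rational charts of the twin-duplication move X9 — toolkit, regions, the two right charts

THE REFLECTION-FREE TWIN-DUPLICATION MOVE "X9" of the line (Legendre's duplication
`Γ(2x)√π = 2^{2x-1}Γ(x)Γ(x+½)`, Andrews–Askey–Roy 1999 Thm 1.5.1, applied at `a` against its application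
at `b`):

  `B(a+b-½, b+½) · B(b, a+½-b) = 4^{a-b} · B(a+b-½, a+½-b) · B(a, 2b)`   (`0 < b`, `½ < a+b`, `b < a+½`),

is realised inside the Kontsevich–Zagier calculus of moves (Kontsevich–Zagier 2001 §1.2, rules (1), (2)) by
the branch-exchange mechanism of the two-duplication move DD, on the PARAMETER TRIANGLE
`Ω = {(t,m) | 0 < t < m < 1}`: writing `s = √(x/(1-x))` for a point of the right box, the quartic
`s⁴ - αs² + βs + 1` (`α = 4/P - 2`, `β = 8√Q/P`, `(P,Q)` the Mellin coordinates) has two positive roots (the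
two right preimages of `(P,Q)`) and two negative roots `-n < -n'`; `Ω ∋ (t,m) = (n², ns)`. In these
coordinates both boxes are RATIONAL images of `Ω`: with `D̂ = m(m-t)² + t(1+m)²` the left box point is
`(t(1+m)²/D̂, ((1-m)/(1+m))²)`, the right box point is `(m²/(t+m²), (t+m²)²/(mD̂))`, and
`P = 4mt/D̂`. This first part supplies

* a small toolkit for differentiating rational charts of the plane in coefficient form
  (`hasFDerivAt_div_coeff`, `hasFDerivAt_chart2`, `det_chart2`), the `ℚ`-semialgebraicity of `Ω` and of
  `Ω' = {(x,m) ∈ (0,1)² | m(1-x) < x}`;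
* `TwinDupStep.exists_chartKappa`: `κ(x,m) = (m²(1-x)/x, m)` carries `Ω'` onto `Ω` (`|det| = m²/x²`);
* `TwinDupStep.exists_chartRho`: `ρ(x,m) = (x, m/D̃)`, `D̃ = m(x-m(1-x))² + x(1-x)(1+m)²`, carries `Ω'` onto the
  open box `(0,1)²` (`|det| = (1-x)(x+m²x-2m³(1-x))/D̃²`; onto by the intermediate value theorem).
Everything is proved; no `def`, no named fact.
-/

noncomputable section

open MeasureTheory Set
open Literature.ModelTheory.ExponentialFields (IsSemialgebraic)

namespace Summit.KontsevichZagierPeriods.FermatIsogeny.BetaProductSectorStubs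

open Literature.NumberTheory.Transcendental
open Literature.NumberTheory.Transcendental.KZ

namespace TwinDupStep

/-! ## Toolkit: rational charts of the plane in coefficient form -/

/-- The first coordinate projection, derivative in coefficient form. [folklore] -/
theorem hasFDerivAt_fst_coeff (z : Fin 2 → ℝ) :
    HasFDerivAt (fun w : Fin 2 → ℝ => w 0) ((1:ℝ) • ContinuousLinearMap.proj (R := ℝ) (φ := fun _ : Fin 2 => ℝ) 0 +
      (0:ℝ) • ContinuousLinearMap.proj (R := ℝ) (φ := fun _ : Fin 2 => ℝ) 1) z := by
  refine (hasFDerivAt_apply 0 z).congr_fderiv (ContinuousLinearMap.ext fun v => ?_)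
  simp

/-- The second coordinate projection, derivative in coefficient form. [folklore] -/
theorem hasFDerivAt_snd_coeff (z : Fin 2 → ℝ) :
    HasFDerivAt (fun w : Fin 2 → ℝ => w 1) ((0:ℝ) • ContinuousLinearMap.proj (R := ℝ) (φ := fun _ : Fin 2 => ℝ) 0 +
      (1:ℝ) • ContinuousLinearMap.proj (R := ℝ) (φ := fun _ : Fin 2 => ℝ) 1) z := by
  refine (hasFDerivAt_apply 1 z).congr_fderiv (ContinuousLinearMap.ext fun v => ?_)
  simp

/-- Quotient rule in coefficient form for scalar functions of two real variables. [folklore] -/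
theorem hasFDerivAt_div_coeff {N D : (Fin 2 → ℝ) → ℝ} {z : Fin 2 → ℝ} {a b c d : ℝ}
    (hN : HasFDerivAt N (a • ContinuousLinearMap.proj (R := ℝ) (φ := fun _ : Fin 2 => ℝ) 0 +
      b • ContinuousLinearMap.proj (R := ℝ) (φ := fun _ : Fin 2 => ℝ) 1) z)
    (hD : HasFDerivAt D (c • ContinuousLinearMap.proj (R := ℝ) (φ := fun _ : Fin 2 => ℝ) 0 +
      d • ContinuousLinearMap.proj (R := ℝ) (φ := fun _ : Fin 2 => ℝ) 1) z)
    (hz : D z ≠ 0) :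
    HasFDerivAt (fun w => N w / D w)
      (((a * D z - N z * c) / D z ^ 2) • ContinuousLinearMap.proj (R := ℝ) (φ := fun _ : Fin 2 => ℝ) 0 +
        ((b * D z - N z * d) / D z ^ 2) • ContinuousLinearMap.proj (R := ℝ) (φ := fun _ : Fin 2 => ℝ) 1) z := by
  have h := hN.mul ((hasFDerivAt_inv hz).comp z hD)
  have hfun : (fun w => N w / D w) = fun w => N w * (D w)⁻¹ := funext fun w => div_eq_mul_inv _ _
  rw [hfun]
  refine h.congr_fderiv (ContinuousLinearMap.ext fun v => ?_)
  simp
  field_simp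
  ring

/-- Assembling a chart of the plane from the coefficient-form derivatives of its two components. [folklore] -/
theorem hasFDerivAt_chart2 {f g : (Fin 2 → ℝ) → ℝ} {z : Fin 2 → ℝ} {f₀ f₁ g₀ g₁ : ℝ}
    (hf : HasFDerivAt f (f₀ • ContinuousLinearMap.proj (R := ℝ) (φ := fun _ : Fin 2 => ℝ) 0 +
      f₁ • ContinuousLinearMap.proj (R := ℝ) (φ := fun _ : Fin 2 => ℝ) 1) z)
    (hg : HasFDerivAt g (g₀ • ContinuousLinearMap.proj (R := ℝ) (φ := fun _ : Fin 2 => ℝ) 0 +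
      g₁ • ContinuousLinearMap.proj (R := ℝ) (φ := fun _ : Fin 2 => ℝ) 1) z) :
    HasFDerivAt (fun w => (![f w, g w] : Fin 2 → ℝ))
      (LinearMap.toContinuousLinearMap (Matrix.toLin' !![f₀, f₁; g₀, g₁])) z := by
  rw [hasFDerivAt_pi']
  refine Fin.forall_fin_two.mpr ⟨?_, ?_⟩
  · have hfe : (fun w : Fin 2 → ℝ => (![f w, g w] : Fin 2 → ℝ) 0) = f := funext fun w => rfl
    rw [hfe]
    refine hf.congr_fderiv (ContinuousLinearMap.ext fun v => ?_)
    change f₀ * v 0 + f₁ * v 1 = Matrix.toLin' !![f₀, f₁; g₀, g₁] v 0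
    rw [Matrix.toLin'_apply]
    simp [Matrix.mulVec, dotProduct, Fin.sum_univ_two]
  · have hge : (fun w : Fin 2 → ℝ => (![f w, g w] : Fin 2 → ℝ) 1) = g := funext fun w => rfl
    rw [hge]
    refine hg.congr_fderiv (ContinuousLinearMap.ext fun v => ?_)
    change g₀ * v 0 + g₁ * v 1 = Matrix.toLin' !![f₀, f₁; g₀, g₁] v 1
    rw [Matrix.toLin'_apply]
    simp [Matrix.mulVec, dotProduct, Fin.sum_univ_two]

/-- The determinant of the assembled chart derivative. [folklore] -/
theorem det_chart2 (f₀ f₁ g₀ g₁ : ℝ) :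
    (LinearMap.toContinuousLinearMap (Matrix.toLin' !![f₀, f₁; g₀, g₁]) :
      (Fin 2 → ℝ) →L[ℝ] (Fin 2 → ℝ)).det = f₀ * g₁ - f₁ * g₀ := by
  change LinearMap.det (Matrix.toLin' !![f₀, f₁; g₀, g₁]) = _
  rw [LinearMap.det_toLin', Matrix.det_fin_two]
  simp

/-! ## The regions (the parameter triangle `Ω` is `QuadStep.isSemialgebraic_wedge`) -/

/-- The region `Ω' = {(x,m) ∈ (0,1)² | m(1-x) < x}` is `ℚ`-semialgebraic. [folklore] -/
theorem isSemialgebraic_regionOmega' :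
    IsSemialgebraic ℚ {z : Fin 2 → ℝ | (z 0 ∈ Set.Ioo (0:ℝ) 1 ∧ z 1 ∈ Set.Ioo (0:ℝ) 1) ∧
      z 1 * (1 - z 0) < z 0} := by
  have h := Literature.ModelTheory.ExponentialFields.isSemialgebraic_setOf_eval_pos (k := ℚ) (R := ℝ)
    (MvPolynomial.X 0 - MvPolynomial.X 1 * (1 - MvPolynomial.X 0) : MvPolynomial (Fin 2) ℚ)
  convert KZ.isSemialgebraic_box2.inter h using 1
  ext z
  simp only [mem_setOf_eq, mem_inter_iff, map_sub, map_mul, map_one, MvPolynomial.aeval_X, sub_pos]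

/-- The denominator of the parameter triangle `D̂(t,m) = m(m-t)² + t(1+m)² = mt² + (1+2m-m²)t + m³` is positive
for `0 ≤ t`, `0 < m ≤ 1`. [folklore] -/
theorem denomL_pos {t m : ℝ} (ht : 0 ≤ t) (hm : 0 < m) (hm1 : m ≤ 1) :
    0 < m * (m - t) ^ 2 + t * (1 + m) ^ 2 := by
  have e : m * (m - t) ^ 2 + t * (1 + m) ^ 2 = m * t ^ 2 + (1 + 2 * m - m ^ 2) * t + m ^ 3 := by ring
  rw [e]
  nlinarith [mul_nonneg hm.le (sq_nonneg t), mul_nonneg (by nlinarith : (0:ℝ) ≤ 1 + 2 * m - m ^ 2) ht, pow_pos hm 3]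

/-! ## The chart `κ(x,m) = (m²(1-x)/x, m)` of `Ω` by `Ω'` -/

/-- **The chart `κ(x,m) = (m²(1-x)/x, m)`** of the parameter triangle `Ω = {0 < t < m < 1}` by the region
`Ω' = {(x,m) ∈ (0,1)² | m(1-x) < x}`: a `ℚ`-rational map, differentiable on `Ω'` with `|det Dκ| = m²/x²`,
injective on `Ω'` and ONTO `Ω` (inverse `x = m²/(t+m²)`). [folklore] -/
theorem exists_chartKappa : ∃ (Φ : (Fin 2 → ℝ) → (Fin 2 → ℝ)) (Φ' : (Fin 2 → ℝ) → (Fin 2 → ℝ) →L[ℝ] (Fin 2 → ℝ)), (∀ z, Φ z 0 = z 1 ^ 2 * (1 - z 0) / z 0) ∧ (∀ z, Φ z 1 = z 1) ∧ Literature.NumberTheory.Transcendental.IsSemialgebraicMapOn ℚ {z : Fin 2 → ℝ | (z 0 ∈ Set.Ioo (0:ℝ) 1 ∧ z 1 ∈ Set.Ioo (0:ℝ) 1) ∧ z 1 * (1 - z 0) < z 0} Φ ∧ (∀ z ∈ {z : Fin 2 → ℝ | (z 0 ∈ Set.Ioo (0:ℝ) 1 ∧ z 1 ∈ Set.Ioo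 (0:ℝ) 1) ∧ z 1 * (1 - z 0) < z 0}, HasFDerivAt Φ (Φ' z) z) ∧ Set.InjOn Φ {z : Fin 2 → ℝ | (z 0 ∈ Set.Ioo (0:ℝ) 1 ∧ z 1 ∈ Set.Ioo (0:ℝ) 1) ∧ z 1 * (1 - z 0) < z 0} ∧ Φ '' {z : Fin 2 → ℝ | (z 0 ∈ Set.Ioo (0:ℝ) 1 ∧ z 1 ∈ Set.Ioo (0:ℝ) 1) ∧ z 1 * (1 - z 0) < z 0} = {z : Fin 2 → ℝ | 0 < z 0 ∧ z 0 < z 1 ∧ z 1 < 1} ∧ (∀ z ∈ {z : Fin 2 → ℝ | (z 0 ∈ Set.Ioo (0:ℝ) 1 ∧ z 1 ∈ Set.Ioo (0:ℝ) 1) ∧ z 1 * (1 - z 0) < z 0}, |(Φ' z).det| = z 1 ^ 2 / z 0 ^ 2) := by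
  set Φ : (Fin 2 → ℝ) → (Fin 2 → ℝ) := fun z => ![z 1 ^ 2 * (1 - z 0) / z 0, z 1] with hΦ
  set Φ' : (Fin 2 → ℝ) → (Fin 2 → ℝ) →L[ℝ] (Fin 2 → ℝ) := fun z => LinearMap.toContinuousLinearMap
    (Matrix.toLin' !![(z 1 ^ 2 * (-1) * z 0 - z 1 ^ 2 * (1 - z 0) * 1) / z 0 ^ 2,
      (2 * z 1 * (1 - z 0) * z 0 - z 1 ^ 2 * (1 - z 0) * 0) / z 0 ^ 2; 0, 1]) with hΦ'
  have hΦ0 : ∀ z, Φ z 0 = z 1 ^ 2 * (1 - z 0) / z 0 := fun z => rfl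
  have hΦ1 : ∀ z, Φ z 1 = z 1 := fun z => rfl
  have hderiv : ∀ z : Fin 2 → ℝ, z 0 ≠ 0 → HasFDerivAt Φ (Φ' z) z := by
    intro z hz
    have h0 := hasFDerivAt_fst_coeff z
    have h1 := hasFDerivAt_snd_coeff z
    have hN : HasFDerivAt (fun w : Fin 2 → ℝ => w 1 ^ 2 * (1 - w 0))
        ((z 1 ^ 2 * (-1)) • ContinuousLinearMap.proj (R := ℝ) (φ := fun _ : Fin 2 => ℝ) 0 +
          (2 * z 1 * (1 - z 0)) • ContinuousLinearMap.proj (R := ℝ) (φ := fun _ : Fin 2 => ℝ) 1) z := by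
      have hf : (fun w : Fin 2 → ℝ => w 1 ^ 2 * (1 - w 0)) = fun w => w 1 * w 1 * (1 - w 0) :=
        funext fun w => by ring
      rw [hf]
      refine ((h1.mul h1).mul (h0.const_sub 1)).congr_fderiv (ContinuousLinearMap.ext fun v => ?_)
      simp
      ring
    exact hasFDerivAt_chart2 (hasFDerivAt_div_coeff hN h0 hz) h1
  have hdet : ∀ z : Fin 2 → ℝ, z 0 ≠ 0 → (Φ' z).det = -(z 1 ^ 2 / z 0 ^ 2) := by
    intro z hz
    rw [hΦ', det_chart2]
    field_simp
    ring
  refine ⟨Φ, Φ', hΦ0, hΦ1, ?_, fun z hz => hderiv z hz.1.1.1.ne', ?_, ?_, fun z hz => ?_⟩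
  · refine IsSemialgebraicMapOn.of_forall isSemialgebraic_regionOmega' (Fin.forall_fin_two.2 ⟨?_, ?_⟩)
    · exact (isSemialgebraicFunOn_aeval_div_aeval isSemialgebraic_regionOmega'
        (MvPolynomial.X 1 ^ 2 * (1 - MvPolynomial.X 0) : MvPolynomial (Fin 2) ℚ) (MvPolynomial.X 0)
        (fun x hx => by simpa using hx.1.1.1.ne')).congr (fun z _ => by simp [hΦ0])
    · exact (isSemialgebraicFunOn_aeval isSemialgebraic_regionOmega'
        (MvPolynomial.X 1 : MvPolynomial (Fin 2) ℚ)).congr (fun z _ => by simp [hΦ1])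
  · intro x hx y hy hxy
    have e0 := congrFun hxy 0
    have e1 := congrFun hxy 1
    simp only [hΦ0, hΦ1] at e0 e1
    have hx0 := hx.1.1.1
    have hy0 := hy.1.1.1
    rw [e1, div_eq_div_iff hx0.ne' hy0.ne'] at e0
    have h2 : y 1 ^ 2 * (y 0 - x 0) = 0 := by linear_combination e0
    rcases mul_eq_zero.1 h2 with h | h
    · linarith [pow_pos hy.1.2.1 2]
    · exact funext (Fin.forall_fin_two.2 ⟨by linarith, e1⟩)
  · ext w
    constructor
    · rintro ⟨z, ⟨⟨h0, h1⟩, h2⟩, rfl⟩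
      simp only [mem_setOf_eq, hΦ0, hΦ1]
      refine ⟨div_pos (mul_pos (pow_pos h1.1 2) (sub_pos.2 h0.2)) h0.1, ?_, h1.2⟩
      rw [div_lt_iff₀ h0.1]
      nlinarith [h1.1]
    · rintro ⟨hw0, hw1, hw2⟩
      have hm : 0 < w 1 := lt_trans hw0 hw1
      have hs : 0 < w 0 + w 1 ^ 2 := by positivity
      refine ⟨![w 1 ^ 2 / (w 0 + w 1 ^ 2), w 1], ⟨⟨?_, hm, hw2⟩, ?_⟩, ?_⟩
      · change w 1 ^ 2 / (w 0 + w 1 ^ 2) ∈ Set.Ioo (0:ℝ) 1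
        exact ⟨div_pos (pow_pos hm 2) hs, by rw [div_lt_one hs]; linarith⟩
      · change w 1 * (1 - w 1 ^ 2 / (w 0 + w 1 ^ 2)) < w 1 ^ 2 / (w 0 + w 1 ^ 2)
        rw [one_sub_div hs.ne', add_sub_cancel_right, ← mul_div_assoc, div_lt_div_iff_of_pos_right hs]
        nlinarith
      · refine funext (Fin.forall_fin_two.2 ⟨?_, rfl⟩)
        change (w 1) ^ 2 * (1 - w 1 ^ 2 / (w 0 + w 1 ^ 2)) / (w 1 ^ 2 / (w 0 + w 1 ^ 2)) = w 0
        have hm2 : (w 1) ^ 2 ≠ 0 := (pow_pos hm 2).ne'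
        field_simp
        ring
  · rw [hdet z hz.1.1.1.ne', abs_neg, abs_of_pos (div_pos (pow_pos hz.1.2.1 2) (pow_pos hz.1.1.1 2))]

/-! ## The chart `ρ(x,m) = (x, m/D̃(x,m))` of the box by `Ω'` -/

/-- On `Ω'`, `x - m(1-x) > 0` and `D̃(x,m) = m(x-m(1-x))² + x(1-x)(1+m)² > 0`. [folklore] -/
theorem denomR_pos {x m : ℝ} (hx : 0 < x) (hx1 : x < 1) (hm : 0 ≤ m) :
    0 < m * (x - m * (1 - x)) ^ 2 + x * (1 - x) * (1 + m) ^ 2 := by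
  have : 0 < 1 - x := sub_pos.2 hx1
  nlinarith [mul_nonneg hm (sq_nonneg (x - m * (1 - x))), (by positivity : 0 < x * (1 - x) * (1 + m) ^ 2)]

/-- `D̃ - m = (1-x)(x-m(1-x))(1-m²)`: the second coordinate of `ρ` stays below `1`. [folklore] -/
theorem denomR_sub (x m : ℝ) :
    m * (x - m * (1 - x)) ^ 2 + x * (1 - x) * (1 + m) ^ 2 - m = (1 - x) * (x - m * (1 - x)) * (1 - m ^ 2) := by
  ring

/-- The difference quotient of `m ↦ m/D̃(x,m)`:
`m₁D̃(x,m₂) - m₂D̃(x,m₁) = (m₁-m₂)(1-x)(x(1+m₁m₂) - (1-x)m₁m₂(m₁+m₂))`. [folklore] -/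
theorem rho_diff (x m₁ m₂ : ℝ) :
    m₁ * (m₂ * (x - m₂ * (1 - x)) ^ 2 + x * (1 - x) * (1 + m₂) ^ 2) -
        m₂ * (m₁ * (x - m₁ * (1 - x)) ^ 2 + x * (1 - x) * (1 + m₁) ^ 2) =
      (m₁ - m₂) * ((1 - x) * (x * (1 + m₁ * m₂) - (1 - x) * m₁ * m₂ * (m₁ + m₂))) := by
  ring

/-- On `Ω'` the last factor of `rho_diff` is positive. [folklore] -/
theorem rho_diff_pos {x m₁ m₂ : ℝ} (hx : 0 < x) (h₁ : 0 < m₁) (h₁' : m₁ < 1)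
    (h₂ : 0 < m₂) (h₂' : m₂ < 1) (hc₁ : m₁ * (1 - x) < x) (hc₂ : m₂ * (1 - x) < x) :
    0 < x * (1 + m₁ * m₂) - (1 - x) * m₁ * m₂ * (m₁ + m₂) := by
  have hmm : 0 < m₁ * m₂ := mul_pos h₁ h₂
  have hmm1 : m₁ * m₂ < 1 := by nlinarith
  have e : x * (1 + m₁ * m₂) - (1 - x) * m₁ * m₂ * (m₁ + m₂) =
      x * (1 - m₁ * m₂) + m₁ * m₂ * ((x - m₁ * (1 - x)) + (x - m₂ * (1 - x))) := by ring
  rw [e]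
  nlinarith [mul_pos hmm (by linarith : 0 < (x - m₁ * (1 - x)) + (x - m₂ * (1 - x)))]

/-- **The chart `ρ(x,m) = (x, m/D̃(x,m))`**, `D̃ = m(x-m(1-x))² + x(1-x)(1+m)²`, of the open box `(0,1)²` by the
region `Ω' = {(x,m) ∈ (0,1)² | m(1-x) < x}`: a `ℚ`-rational map, differentiable on `Ω'` with
`|det Dρ| = (1-x)(x + m²x - 2m³(1-x))/D̃²`, injective on `Ω'` (`rho_diff`) and ONTO the box (the second
coordinate increases from `0` at `m = 0` to `1` at `m = min(1, x/(1-x))`: intermediate value theorem).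
[folklore] -/
theorem exists_chartRho :
    ∃ (Φ : (Fin 2 → ℝ) → (Fin 2 → ℝ)) (Φ' : (Fin 2 → ℝ) → (Fin 2 → ℝ) →L[ℝ] (Fin 2 → ℝ)),
      (∀ z, Φ z 0 = z 0) ∧
      (∀ z, Φ z 1 = z 1 / (z 1 * (z 0 - z 1 * (1 - z 0)) ^ 2 + z 0 * (1 - z 0) * (1 + z 1) ^ 2)) ∧
      IsSemialgebraicMapOn ℚ {z : Fin 2 → ℝ | (z 0 ∈ Set.Ioo (0:ℝ) 1 ∧ z 1 ∈ Set.Ioo (0:ℝ) 1) ∧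
        z 1 * (1 - z 0) < z 0} Φ ∧
      (∀ z ∈ {z : Fin 2 → ℝ | (z 0 ∈ Set.Ioo (0:ℝ) 1 ∧ z 1 ∈ Set.Ioo (0:ℝ) 1) ∧ z 1 * (1 - z 0) < z 0},
        HasFDerivAt Φ (Φ' z) z) ∧
      Set.InjOn Φ {z : Fin 2 → ℝ | (z 0 ∈ Set.Ioo (0:ℝ) 1 ∧ z 1 ∈ Set.Ioo (0:ℝ) 1) ∧ z 1 * (1 - z 0) < z 0} ∧
      Φ '' {z : Fin 2 → ℝ | (z 0 ∈ Set.Ioo (0:ℝ) 1 ∧ z 1 ∈ Set.Ioo (0:ℝ) 1) ∧ z 1 * (1 - z 0) < z 0} =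
        {z : Fin 2 → ℝ | z 0 ∈ Set.Ioo (0:ℝ) 1 ∧ z 1 ∈ Set.Ioo (0:ℝ) 1} ∧
      (∀ z ∈ {z : Fin 2 → ℝ | (z 0 ∈ Set.Ioo (0:ℝ) 1 ∧ z 1 ∈ Set.Ioo (0:ℝ) 1) ∧ z 1 * (1 - z 0) < z 0},
        |(Φ' z).det| = (1 - z 0) * (z 0 + z 1 ^ 2 * z 0 - 2 * z 1 ^ 3 * (1 - z 0)) /
          (z 1 * (z 0 - z 1 * (1 - z 0)) ^ 2 + z 0 * (1 - z 0) * (1 + z 1) ^ 2) ^ 2) := by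
  set Φ : (Fin 2 → ℝ) → (Fin 2 → ℝ) :=
    fun z => ![z 0, z 1 / (z 1 * (z 0 - z 1 * (1 - z 0)) ^ 2 + z 0 * (1 - z 0) * (1 + z 1) ^ 2)] with hΦ
  -- coefficient-form partial derivatives of `D̃`
  set c₀ : (Fin 2 → ℝ) → ℝ := fun z => 2 * z 1 * (z 0 - z 1 * (1 - z 0)) * (1 + z 1) +
    (1 - 2 * z 0) * (1 + z 1) ^ 2 with hc₀
  set c₁ : (Fin 2 → ℝ) → ℝ := fun z => (z 0 - z 1 * (1 - z 0)) ^ 2 -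
    2 * z 1 * (z 0 - z 1 * (1 - z 0)) * (1 - z 0) + 2 * z 0 * (1 - z 0) * (1 + z 1) with hc₁
  set Dt : (Fin 2 → ℝ) → ℝ := fun z => z 1 * (z 0 - z 1 * (1 - z 0)) ^ 2 + z 0 * (1 - z 0) * (1 + z 1) ^ 2
    with hDt
  set Φ' : (Fin 2 → ℝ) → (Fin 2 → ℝ) →L[ℝ] (Fin 2 → ℝ) := fun z => LinearMap.toContinuousLinearMap
    (Matrix.toLin' !![1, 0; (0 * Dt z - z 1 * c₀ z) / Dt z ^ 2, (1 * Dt z - z 1 * c₁ z) / Dt z ^ 2]) with hΦ'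
  have hΦ0 : ∀ z, Φ z 0 = z 0 := fun z => rfl
  have hΦ1 : ∀ z, Φ z 1 = z 1 / (z 1 * (z 0 - z 1 * (1 - z 0)) ^ 2 + z 0 * (1 - z 0) * (1 + z 1) ^ 2) :=
    fun z => rfl
  have hderiv : ∀ z : Fin 2 → ℝ, Dt z ≠ 0 → HasFDerivAt Φ (Φ' z) z := by
    intro z hz
    have h0 := hasFDerivAt_fst_coeff z
    have h1 := hasFDerivAt_snd_coeff z
    have hD : HasFDerivAt Dt (c₀ z • ContinuousLinearMap.proj (R := ℝ) (φ := fun _ : Fin 2 => ℝ) 0 +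
        c₁ z • ContinuousLinearMap.proj (R := ℝ) (φ := fun _ : Fin 2 => ℝ) 1) z := by
      have hu := h0.sub (h1.mul (h0.const_sub 1))
      have h := (h1.mul (hu.mul hu)).add ((h0.mul (h0.const_sub 1)).mul ((h1.const_add 1).mul (h1.const_add 1)))
      have hf : Dt = fun w => w 1 * ((w 0 - w 1 * (1 - w 0)) * (w 0 - w 1 * (1 - w 0))) +
          w 0 * (1 - w 0) * ((1 + w 1) * (1 + w 1)) := funext fun w => by rw [hDt]; ring
      rw [hf]
      refine h.congr_fderiv (ContinuousLinearMap.ext fun v => ?_)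
      simp [hc₀, hc₁]
      ring
    exact hasFDerivAt_chart2 h0 (hasFDerivAt_div_coeff h1 hD hz)
  have hdet : ∀ z : Fin 2 → ℝ, Dt z ≠ 0 → (Φ' z).det =
      (1 - z 0) * (z 0 + z 1 ^ 2 * z 0 - 2 * z 1 ^ 3 * (1 - z 0)) / Dt z ^ 2 := by
    intro z hz
    rw [hΦ', det_chart2]
    field_simp
    rw [hDt, hc₁]
    ring
  have hDtpos : ∀ z ∈ {z : Fin 2 → ℝ | (z 0 ∈ Set.Ioo (0:ℝ) 1 ∧ z 1 ∈ Set.Ioo (0:ℝ) 1) ∧ z 1 * (1 - z 0) < z 0},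
      0 < Dt z := fun z hz => denomR_pos hz.1.1.1 hz.1.1.2 hz.1.2.1.le
  refine ⟨Φ, Φ', hΦ0, hΦ1, ?_, fun z hz => hderiv z (hDtpos z hz).ne', ?_, ?_, fun z hz => ?_⟩
  · refine IsSemialgebraicMapOn.of_forall isSemialgebraic_regionOmega' (Fin.forall_fin_two.2 ⟨?_, ?_⟩)
    · exact (isSemialgebraicFunOn_aeval isSemialgebraic_regionOmega'
        (MvPolynomial.X 0 : MvPolynomial (Fin 2) ℚ)).congr (fun z _ => by simp [hΦ0])
    · exact (isSemialgebraicFunOn_aeval_div_aeval isSemialgebraic_regionOmega'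
        (MvPolynomial.X 1 : MvPolynomial (Fin 2) ℚ)
        (MvPolynomial.X 1 * (MvPolynomial.X 0 - MvPolynomial.X 1 * (1 - MvPolynomial.X 0)) ^ 2 +
          MvPolynomial.X 0 * (1 - MvPolynomial.X 0) * (1 + MvPolynomial.X 1) ^ 2)
        (fun x hx => by simpa using (hDtpos x hx).ne')).congr (fun z _ => by simp [hΦ1])
  · intro x hx y hy hxy
    have e0 := congrFun hxy 0
    have e1 := congrFun hxy 1
    simp only [hΦ0, hΦ1] at e0 e1
    have hx2 : x 1 * (1 - y 0) < y 0 := e0 ▸ hx.2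
    rw [e0] at e1
    rw [div_eq_div_iff (denomR_pos hy.1.1.1 hy.1.1.2 hx.1.2.1.le).ne'
      (denomR_pos hy.1.1.1 hy.1.1.2 hy.1.2.1.le).ne'] at e1
    have key := rho_diff (y 0) (x 1) (y 1)
    rw [e1, sub_self] at key
    have hpos : 0 < (1 - y 0) * (y 0 * (1 + x 1 * y 1) - (1 - y 0) * x 1 * y 1 * (x 1 + y 1)) :=
      mul_pos (sub_pos.2 hy.1.1.2) (rho_diff_pos hy.1.1.1 hx.1.2.1 hx.1.2.2 hy.1.2.1 hy.1.2.2 hx2 hy.2)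
    have h1 : x 1 = y 1 := by
      rcases mul_eq_zero.1 key.symm with h | h
      · linarith
      · linarith
    exact funext (Fin.forall_fin_two.2 ⟨e0, h1⟩)
  · ext w
    constructor
    · rintro ⟨z, hz, rfl⟩
      obtain ⟨⟨h0, h1⟩, h2⟩ := hz
      have hD := hDtpos z ⟨⟨h0, h1⟩, h2⟩
      simp only [mem_setOf_eq, hΦ0, hΦ1]
      refine ⟨h0, div_pos h1.1 hD, ?_⟩
      rw [div_lt_one hD, ← sub_pos]
      change 0 < z 1 * (z 0 - z 1 * (1 - z 0)) ^ 2 + z 0 * (1 - z 0) * (1 + z 1) ^ 2 - z 1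
      rw [denomR_sub]
      exact mul_pos (mul_pos (sub_pos.2 h0.2) (by linarith)) (by nlinarith [h1.1, h1.2])
    · rintro ⟨hw0, hw1⟩
      -- intermediate value theorem for `m ↦ m / D̃(w 0, m)` on `[0, M]`, `M = min 1 (w 0/(1 - w 0))`
      set f : ℝ → ℝ := fun m => m / (m * (w 0 - m * (1 - w 0)) ^ 2 + w 0 * (1 - w 0) * (1 + m) ^ 2) with hf
      set M : ℝ := min 1 (w 0 / (1 - w 0)) with hM
      have h1w : 0 < 1 - w 0 := sub_pos.2 hw0.2
      have hM0 : 0 < M := lt_min one_pos (div_pos hw0.1 h1w)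
      have hM1 : M ≤ 1 := min_le_left _ _
      have hMx : M * (1 - w 0) ≤ w 0 := by
        calc M * (1 - w 0) ≤ w 0 / (1 - w 0) * (1 - w 0) :=
              mul_le_mul_of_nonneg_right (min_le_right _ _) h1w.le
          _ = w 0 := div_mul_cancel₀ _ h1w.ne'
      have hfc : ContinuousOn f (Set.Icc 0 M) := by
        apply ContinuousOn.div (Continuous.continuousOn (by fun_prop)) (Continuous.continuousOn (by fun_prop))
        intro m hm
        exact (denomR_pos hw0.1 hw0.2 hm.1).ne'
      have hf0 : f 0 = 0 := by simp [hf]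
      have hfM : f M = 1 := by
        rw [hf]
        simp only
        rw [div_eq_one_iff_eq (denomR_pos hw0.1 hw0.2 hM0.le).ne', eq_comm, ← sub_eq_zero, denomR_sub]
        rcases le_total 1 (w 0 / (1 - w 0)) with h | h
        · have : M = 1 := min_eq_left h
          rw [this]
          ring
        · have : M = w 0 / (1 - w 0) := min_eq_right h
          rw [this, div_mul_cancel₀ _ h1w.ne', sub_self, mul_zero, zero_mul]
      have hmem : w 1 ∈ Set.Ioo (f 0) (f M) := by rw [hf0, hfM]; exact hw1
      obtain ⟨m, ⟨hm0, hmM⟩, hm⟩ := intermediate_value_Ioo hM0.le hfc hmem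
      refine ⟨![w 0, m], ⟨⟨hw0, hm0, lt_of_lt_of_le hmM hM1⟩, ?_⟩, funext (Fin.forall_fin_two.2 ⟨rfl, hm⟩)⟩
      change m * (1 - w 0) < w 0
      calc m * (1 - w 0) < M * (1 - w 0) := mul_lt_mul_of_pos_right hmM h1w
        _ ≤ w 0 := hMx
  · rw [hdet z (hDtpos z hz).ne', abs_of_pos]
    refine div_pos (mul_pos (sub_pos.2 hz.1.1.2) ?_) (pow_pos (hDtpos z hz) 2)
    have h1 : 2 * z 1 ^ 3 * (1 - z 0) < 2 * z 1 ^ 2 * z 0 := by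
      have := hz.2
      nlinarith [pow_pos hz.1.2.1 2]
    have h2 : 0 < z 0 * (1 - z 1 ^ 2) := mul_pos hz.1.1.1 (by nlinarith [hz.1.2.1, hz.1.2.2])
    have e : z 0 * (1 - z 1 ^ 2) = z 0 + z 1 ^ 2 * z 0 - 2 * z 1 ^ 2 * z 0 := by ring
    linarith

end TwinDupStep

end Summit.KontsevichZagierPeriods.FermatIsogeny.BetaProductSectorStubs

end
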